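import Summits.HubbardSuperconductivity.HubbardSuperconductivity.Theorems.TwSourcedCondensation.Negative.SourceResponseStructure
import Literature.MathematicalPhysics.QuantumLattice.FockRelabel

/-!
# `B₁g`-blindness of the on-site pair: the on-site anomalous Gibbs amplitude of the
# `d`-wave–sourced Hubbard torus vanishes identically (all `U, β, L`, every complex source)

`--supports stmt-HubbardSuperconductivity-1697` (crux `TwSourcedCondensation`, line
`zero-source-pair-cumulants`); no definition is introduced.

For the grand-canonical Hubbard torus with a (possibly complex) `d_{x²-y²}` pair source,
`H_z = hubbardTorusWith 2 L 1 U μ - z(Δ_d + Δ_d†)`, the Gibbs functional kills the ON-SITE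
(`s`-wave) pair at every site:

  `⟨c_{x↑} c_{x↓}⟩_{β, H_z} = 0`   for all `L ≥ 1`, `β`, `U`, `μ`, `z ∈ ℂ`, `x`
  (`dWaveSourceComplex_onSitePair_gibbsState_eq_zero`; real source / `dWaveSourceTorus`:
  `dWaveSourceTorus_onSitePair_gibbsState_eq_zero`; summed over the torus and for the creation
  pair likewise).

MECHANISM (three exact symmetries, all in the tree): (i) TRANSLATIONS `T_v` fix `H_z` and move
`c_{x↑}c_{x↓}` to `c_{x+v,↑}c_{x+v,↓}`, so the amplitude does not depend on the site
(`FockRelabel`: `relabel_translate_hubbardTorusWith`, `relabel_translate_pairField`);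
(ii) the ROTATION by `π/2` fixes the Hubbard part and flips the sign of the `B₁g` pair field
(`relabel_d4Perm_pairField_dWave`, `χ_{B₁g}(r) = -1`), i.e. maps `H_z` to `H_{-z}` while moving the
on-site pair to the rotated site: with (i), the amplitude is EVEN in `z`; (iii) the constant GAUGE
rotation `W = e^{iπN/2}` also maps `H_z` to `H_{-z}` (`gaugeW_conj_*`, Negative/SourceResponseStructure)
but flips the sign of every pair annihilator `c c`: the amplitude is ODD in `z`. Even and odd ⇒ zero.

WHY IT MATTERS for the engine of cruxes 1696/1697 (zero-source pair-cumulant comparison (K_c)):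
by Hellmann–Feynman `∂_U log Z_L(U,z) = -β Σ_x ⟨n_{x↑}n_{x↓}⟩_{β,H_z}`, and in the quasi-free
sourced state at `U = 0` Wick's rule gives `⟨n_{x↑}n_{x↓}⟩ = ⟨n_{x↑}⟩⟨n_{x↓}⟩ + |⟨c_{x↑}c_{x↓}⟩|² -
|⟨c†_{x↑}c_{x↓}⟩|²`; the present identity removes the anomalous (vertex) term at EVERY source
strength, so the first-order interaction correction to all pair-field cumulants is the pure Hartree
shift — the structural reason the `∀ η` precision of (K_c) is attainable at first order
(STRATEGY-CENSUS §5 (i) of the crux directory). Here only the exact identity is proved.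

References: T. Koma, H. Tasaki, PRL 68 (1992) 3248, eqs. (5)–(8) (gauge rotation);
D. J. Scalapino, Phys. Rep. 250 (1995) 329, §2 (the `d_{x²-y²}` channel is `B₁g`);
O. Bratteli, D. W. Robinson, *Operator Algebras and QSM II* (1997), Thm. 5.2.5 (implementability
of one-particle symmetries on Fock space).
-/

noncomputable section

namespace Summit.HubbardSuperconductivity.HubbardSuperconductivity.Theorems

open Matrix Finset Literature.MathematicalPhysics.QuantumLattice Literature.Probability.LatticeModels
open Summit.HubbardSuperconductivity.HubbardSuperconductivity.Theorems.TwSourcedCondensation.Negative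

/-! ### Unitary covariance of Gibbs functionals -/

/-- **Gibbs functionals are covariant under unitary conjugation**: for `W Wᴴ = Wᴴ W = 1`,
`⟨W A Wᴴ⟩_{β, W K Wᴴ} = ⟨A⟩_{β, K}` (no Hermiticity of `K` is needed). [folklore] -/
theorem gibbsState_unitaryConj {m : Type*} [Fintype m] [DecidableEq m] {W : Matrix m m ℂ}
    (hW : W * Wᴴ = 1) (hW' : Wᴴ * W = 1) (β : ℝ) (K A : Matrix m m ℂ) :
    gibbsState β (W * K * Wᴴ) (W * A * Wᴴ) = gibbsState β K A := by
  have hWu : W ∈ unitary (Matrix m m ℂ) := by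
    rw [Unitary.mem_iff, star_eq_conjTranspose]
    exact ⟨hW', hW⟩
  have hunit : IsUnit W := ⟨Unitary.toUnits ⟨W, hWu⟩, rfl⟩
  have hinv : W⁻¹ = Wᴴ := Matrix.inv_eq_right_inv hW
  have hZ : partitionFn β (W * K * Wᴴ) = partitionFn β K := by
    have h := partitionFn_unitary_conj hWu β K
    rwa [star_eq_conjTranspose] at h
  have hw : gibbsWeight β (W * K * Wᴴ) = W * gibbsWeight β K * Wᴴ := by
    rw [gibbsWeight, gibbsWeight, ← hinv, show -(β : ℂ) • (W * K * W⁻¹) =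
      W * (-(β : ℂ) • K) * W⁻¹ by rw [Matrix.mul_smul, Matrix.smul_mul], Matrix.exp_conj _ _ hunit]
  rw [gibbsState_apply, gibbsState_apply, hZ, hw]
  congr 1
  calc (W * gibbsWeight β K * Wᴴ * (W * A * Wᴴ)).trace
      = (W * (gibbsWeight β K * (Wᴴ * W) * A) * Wᴴ).trace := by simp only [Matrix.mul_assoc]
    _ = (W * (gibbsWeight β K * A) * Wᴴ).trace := by rw [hW', Matrix.mul_one]
    _ = (Wᴴ * W * (gibbsWeight β K * A)).trace := by rw [trace_mul_cycle, Matrix.mul_assoc]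
    _ = (gibbsWeight β K * A).trace := by rw [hW', Matrix.one_mul]

/-! ### The complex-sourced torus Hamiltonian under translations, the rotation by `π/2`, and the
gauge rotation by `e^{iπ/2}` -/

section Torus

variable (L : ℕ) [NeZero L]

/-- **Translation invariance of the sourced Hamiltonian**: `T_v H_z T_v⁻¹ = H_z` for every complex
source `z` (the pair field of any form factor is translation invariant). [cite: BenfattoGiulianiMastropietro2006, §2.2] -/
theorem relabel_translate_dWaveSourceComplex (v : TorusSite 2 L) (U μ : ℝ) (z : ℂ) :
    relabel (Orb.translate v) (hubbardTorusWith 2 L 1 U μ -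
        z • (pairField dWaveFormFactor L + (pairField dWaveFormFactor L)ᴴ)) =
      hubbardTorusWith 2 L 1 U μ - z • (pairField dWaveFormFactor L + (pairField dWaveFormFactor L)ᴴ) := by
  rw [relabel_sub, relabel_smul, relabel_add, relabel_conjTranspose, relabel_translate_hubbardTorusWith,
    relabel_translate_pairField]

/-- **The rotation by `π/2` reverses the `d`-wave source**: `U_r H_z U_r⁻¹ = H_{-z}` (the Hubbard
part is `D₄` invariant, the `B₁g` pair field changes sign). [cite: Scalapino1995, §2 eq. (2.3)] -/
theorem relabel_rot_dWaveSourceComplex (U μ : ℝ) (z : ℂ) :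
    relabel (Orb.d4Perm (DihedralGroup.r 1)) (hubbardTorusWith 2 L 1 U μ -
        z • (pairField dWaveFormFactor L + (pairField dWaveFormFactor L)ᴴ)) =
      hubbardTorusWith 2 L 1 U μ - (-z) • (pairField dWaveFormFactor L + (pairField dWaveFormFactor L)ᴴ) := by
  -- `χ_{B₁g}(r) = -1` (also `CapRgSymmetricCertificatePinned.Negative.b1gChar_r_one`; inlined to keep imports light)
  have hχ : b1gChar (DihedralGroup.r 1) = -1 := by
    haveI : Fact (1 < 4) := ⟨by norm_num⟩
    show (-1 : ℂ) ^ (1 : ZMod 4).val = -1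
    rw [ZMod.val_one, pow_one]
  rw [relabel_sub, relabel_smul, relabel_add, relabel_conjTranspose, relabel_d4Perm_hubbardTorusWith,
    relabel_d4Perm_pairField_dWave, hχ, conjTranspose_smul]
  simp only [star_neg, star_one, neg_smul, one_smul, smul_add, smul_neg]

/-- **The gauge rotation by `e^{iπ/2}` reverses a COMPLEX source**: `W H_z Wᴴ = H_{-z}`
(`gaugeW_conj_dWaveSourceTorus` is the real-source case). [cite: KomaTasakiPRL1992, eqs. (7)–(8)] -/
theorem gaugeW_conj_dWaveSourceComplex (U μ : ℝ) (z : ℂ) :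
    phaseGauge (fun _ : FermionTorus 2 L => Circle.exp (Real.pi / 2)) *
        (hubbardTorusWith 2 L 1 U μ - z • (pairField dWaveFormFactor L + (pairField dWaveFormFactor L)ᴴ)) *
        (phaseGauge (fun _ : FermionTorus 2 L => Circle.exp (Real.pi / 2)))ᴴ =
      hubbardTorusWith 2 L 1 U μ - (-z) • (pairField dWaveFormFactor L + (pairField dWaveFormFactor L)ᴴ) := by
  rw [Matrix.mul_sub, Matrix.sub_mul, gaugeW_conj_hubbardTorusWith, Matrix.mul_smul, Matrix.smul_mul,
    Matrix.mul_add, Matrix.add_mul, gaugeW_conj_pairField, gaugeW_conj_pairField_conjTranspose]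
  simp only [smul_add, smul_neg, neg_smul]

/-! ### The on-site anomalous amplitude vanishes -/

/-- **Site independence** (translations): `⟨c_{y↑}c_{y↓}⟩_{β,H_z} = ⟨c_{x↑}c_{x↓}⟩_{β,H_z}`. [folklore] -/
theorem dWaveSourceComplex_onSitePair_gibbsState_eq (β U μ : ℝ) (z : ℂ) (x y : TorusSite 2 L) :
    gibbsState β (hubbardTorusWith 2 L 1 U μ -
        z • (pairField dWaveFormFactor L + (pairField dWaveFormFactor L)ᴴ))
        (annihilation (orb (FermionTorus.ofTorusSite y) 0) * annihilation (orb (FermionTorus.ofTorusSite y) 1)) =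
      gibbsState β (hubbardTorusWith 2 L 1 U μ -
        z • (pairField dWaveFormFactor L + (pairField dWaveFormFactor L)ᴴ))
        (annihilation (orb (FermionTorus.ofTorusSite x) 0) * annihilation (orb (FermionTorus.ofTorusSite x) 1)) := by
  have h := gibbsState_relabel (Orb.translate (y - x)) β
    (hubbardTorusWith 2 L 1 U μ - z • (pairField dWaveFormFactor L + (pairField dWaveFormFactor L)ᴴ))
    (annihilation (orb (FermionTorus.ofTorusSite x) 0) * annihilation (orb (FermionTorus.ofTorusSite x) 1))
  rw [relabel_translate_dWaveSourceComplex, relabel_mul, relabel_translate_annihilation,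
    relabel_translate_annihilation, add_sub_cancel] at h
  -- `convert`, not `exact`: the `DecidableEq` instance on `Finset (Orb _)` carried by the generic
  -- `gibbsState_relabel` (derived from the linear order) differs syntactically from the one
  -- synthesised here (cf. the implementation note of `FockRelabel`).
  convert h using 3

/-- **Evenness in the source** (rotation by `π/2` + translations):
`⟨c_{x↑}c_{x↓}⟩_{β,H_{-z}} = ⟨c_{x↑}c_{x↓}⟩_{β,H_z}`. [cite: Scalapino1995, §2] -/
theorem dWaveSourceComplex_onSitePair_gibbsState_neg (β U μ : ℝ) (z : ℂ) (x : TorusSite 2 L) :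
    gibbsState β (hubbardTorusWith 2 L 1 U μ -
        (-z) • (pairField dWaveFormFactor L + (pairField dWaveFormFactor L)ᴴ))
        (annihilation (orb (FermionTorus.ofTorusSite x) 0) * annihilation (orb (FermionTorus.ofTorusSite x) 1)) =
      gibbsState β (hubbardTorusWith 2 L 1 U μ -
        z • (pairField dWaveFormFactor L + (pairField dWaveFormFactor L)ᴴ))
        (annihilation (orb (FermionTorus.ofTorusSite x) 0) * annihilation (orb (FermionTorus.ofTorusSite x) 1)) := by
  have h := gibbsState_relabel (Orb.d4Perm (DihedralGroup.r 1)) β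
    (hubbardTorusWith 2 L 1 U μ - z • (pairField dWaveFormFactor L + (pairField dWaveFormFactor L)ᴴ))
    (annihilation (orb (FermionTorus.ofTorusSite x) 0) * annihilation (orb (FermionTorus.ofTorusSite x) 1))
  rw [relabel_rot_dWaveSourceComplex, relabel_mul, relabel_d4Perm_annihilation,
    relabel_d4Perm_annihilation] at h
  have h' : gibbsState β (hubbardTorusWith 2 L 1 U μ -
        (-z) • (pairField dWaveFormFactor L + (pairField dWaveFormFactor L)ᴴ))
        (annihilation (orb (FermionTorus.ofTorusSite (d4Site (DihedralGroup.r 1) x)) 0) *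
          annihilation (orb (FermionTorus.ofTorusSite (d4Site (DihedralGroup.r 1) x)) 1)) =
      gibbsState β (hubbardTorusWith 2 L 1 U μ -
        z • (pairField dWaveFormFactor L + (pairField dWaveFormFactor L)ᴴ))
        (annihilation (orb (FermionTorus.ofTorusSite x) 0) * annihilation (orb (FermionTorus.ofTorusSite x) 1)) := by
    convert h using 3
  rw [dWaveSourceComplex_onSitePair_gibbsState_eq L β U μ (-z) x (d4Site (DihedralGroup.r 1) x)] at h'
  exact h'

/-- **Oddness in the source** (gauge rotation by `e^{iπ/2}`):
`⟨c_{x↑}c_{x↓}⟩_{β,H_z} = -⟨c_{x↑}c_{x↓}⟩_{β,H_{-z}}`. [cite: KomaTasakiPRL1992, eqs. (5)–(8)] -/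
theorem dWaveSourceComplex_onSitePair_gibbsState_eq_neg (β U μ : ℝ) (z : ℂ) (x : TorusSite 2 L) :
    gibbsState β (hubbardTorusWith 2 L 1 U μ -
        z • (pairField dWaveFormFactor L + (pairField dWaveFormFactor L)ᴴ))
        (annihilation (orb (FermionTorus.ofTorusSite x) 0) * annihilation (orb (FermionTorus.ofTorusSite x) 1)) =
      -gibbsState β (hubbardTorusWith 2 L 1 U μ -
        (-z) • (pairField dWaveFormFactor L + (pairField dWaveFormFactor L)ᴴ))
        (annihilation (orb (FermionTorus.ofTorusSite x) 0) * annihilation (orb (FermionTorus.ofTorusSite x) 1)) := by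
  have h := gibbsState_unitaryConj (gaugeW_mul_conjTranspose_self L) (conjTranspose_gaugeW_mul_self L) β
    (hubbardTorusWith 2 L 1 U μ - z • (pairField dWaveFormFactor L + (pairField dWaveFormFactor L)ᴴ))
    (annihilation (orb (FermionTorus.ofTorusSite x) 0) * annihilation (orb (FermionTorus.ofTorusSite x) 1))
  rw [gaugeW_conj_dWaveSourceComplex, phaseGauge_halfPi_conj_annihilation_mul_annihilation, map_neg] at h
  rw [← h]

/-- **`B₁g`-blindness of the on-site pair.** For the `d`-wave–sourced grand-canonical Hubbard
torus with ANY complex source `z`, the on-site anomalous Gibbs amplitude vanishes identically: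
`⟨c_{x↑} c_{x↓}⟩_{β, H_z} = 0` for all `L ≥ 1`, `β`, `U`, `μ`, `z`, `x` (translations + rotation
by `π/2` make it even in `z`, the gauge rotation makes it odd). [cite: Scalapino1995, §2] -/
theorem dWaveSourceComplex_onSitePair_gibbsState_eq_zero :
    ∀ (L : ℕ) [NeZero L] (β U μ : ℝ) (z : ℂ) (x : Literature.Probability.LatticeModels.TorusSite 2 L), Matrix.gibbsState β (Literature.MathematicalPhysics.QuantumLattice.hubbardTorusWith 2 L 1 U μ - z • (Literature.MathematicalPhysics.QuantumLattice.pairField Literature.MathematicalPhysics.QuantumLattice.dWaveFormFactor L + (Literature.MathematicalPhysics.QuantumLattice.pairField Literature.MathematicalPhysics.QuantumLattice.dWaveFormFactor L)ᴴ)) (Literature.MathematicalPhysics.QuantumLattice.annihilation (Literature.MathematicalPhysics.QuantumLattice.orb (Literature.MathematicalPhysics.QuantumLattice.FermionTorus.ofTorusSite x) 0) * Literature.MathematicalPhysics.QuantumLattice.annihilation (Literature.MathematicalPhysics.QuantumLattice.orb (Literature.MathematicalPhysics.QuantumLattice.FermionTorus.ofTorusSite x) 1)) = 0 := by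
  intro L _ β U μ z x
  have h1 := dWaveSourceComplex_onSitePair_gibbsState_eq_neg L β U μ z x
  rw [dWaveSourceComplex_onSitePair_gibbsState_neg] at h1
  -- `a = -a`
  linear_combination h1 / 2

/-- **Real source (`dWaveSourceTorus`)**: `⟨c_{x↑} c_{x↓}⟩_{β, H_{L,h}} = 0` for all `L ≥ 1`, `β`,
`U`, `μ`, `h`, `x`. [cite: Scalapino1995, §2] -/
theorem dWaveSourceTorus_onSitePair_gibbsState_eq_zero (β U μ h : ℝ) (x : TorusSite 2 L) :
    gibbsState β (dWaveSourceTorus L U μ h)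
        (annihilation (orb (FermionTorus.ofTorusSite x) 0) * annihilation (orb (FermionTorus.ofTorusSite x) 1)) = 0 :=
  dWaveSourceComplex_onSitePair_gibbsState_eq_zero L β U μ (h : ℂ) x

/-- The creation pair likewise: `⟨c†_{x↓} c†_{x↑}⟩_{β, H_{L,h}} = 0` (adjoint of the previous
statement in the Gibbs state of the Hermitian `H_{L,h}`). [cite: Scalapino1995, §2] -/
theorem dWaveSourceTorus_onSitePairCreation_gibbsState_eq_zero (β U μ h : ℝ) (x : TorusSite 2 L) :
    gibbsState β (dWaveSourceTorus L U μ h)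
        (creation (orb (FermionTorus.ofTorusSite x) 1) * creation (orb (FermionTorus.ofTorusSite x) 0)) = 0 := by
  have hH : (dWaveSourceTorus L U μ h).IsHermitian :=
    dWaveSourceTorus_isHermitian L (isHermitian_hamiltonianWith (fermionTorusGraph 2 L) 1 U μ) h
  have h0 := dWaveSourceTorus_onSitePair_gibbsState_eq_zero L β U μ h x
  have hadj : creation (orb (FermionTorus.ofTorusSite x) 1) * creation (orb (FermionTorus.ofTorusSite x) 0) =
      (annihilation (orb (FermionTorus.ofTorusSite x) 0) * annihilation (orb (FermionTorus.ofTorusSite x) 1))ᴴ := by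
    rw [conjTranspose_mul, creation, creation]
  rw [hadj, gibbsState_conjTranspose β hH, h0, star_zero]

/-- **Summed form**: the on-site `s`-wave pair field `Σ_x c_{x↑}c_{x↓}` has zero Gibbs
expectation in the `d`-wave–sourced torus, at every `U, β, L, h`. [cite: Scalapino1995, §2] -/
theorem dWaveSourceTorus_sum_onSitePair_gibbsState_eq_zero (β U μ h : ℝ) :
    gibbsState β (dWaveSourceTorus L U μ h)
        (∑ x : TorusSite 2 L, annihilation (orb (FermionTorus.ofTorusSite x) 0) *
          annihilation (orb (FermionTorus.ofTorusSite x) 1)) = 0 := by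
  rw [map_sum]
  exact Finset.sum_eq_zero fun x _ => dWaveSourceTorus_onSitePair_gibbsState_eq_zero L β U μ h x

end Torus

end Summit.HubbardSuperconductivity.HubbardSuperconductivity.Theorems
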